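import Literature.NumberTheory.GaloisCohomology.Howard2004.SelmerTriples
import Literature.NumberTheory.EllipticCurves.HeegnerPointsKolyvaginPairing
import HarnessLib

/-!
# `Θ_q = θ ∘ ρ̄(δ_q)` is a REFLECTION of `T̄` at an engine prime — the letter `hΘ` of Lemma 1.5.3 for EVERY
# conjugation datum, from H.4 + H.5(a)(c) (proofs file)

Topic `NumberTheory/GaloisCohomology/Howard2004`.  THEOREMS ONLY: no definition, no named fact, no instance,
no notation, no `sorry`.

B. Howard, *The Heegner point Kolyvagin system*, Compositio Math. **140** (2004) = arXiv:1202.6340, Lemma 1.5.3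
(proof, p. 10 L12–16): «the action of complex conjugation splits `H¹_f(K_λ, T̄)` and `H¹_s(K_λ, T̄)` each into
one-dimensional eigenspaces by H.5 and the isomorphisms `H¹_f(K_λ, T̄) ≅ T̄ ≅ H¹_s(K_λ, T̄) ⊗ k^×` of Prop. 1.1.7».
In the tree (`InertEigenlinesProofs`, seat x10b-p1-w5 g8) the complex conjugation on `H¹(K_q, T̄)` is the datum's
`τ_q = θ_* ∘ transport_q`, and under evaluation at a Frobenius / at `σ₀` it becomes `Θ_q := θ ∘ ρ̄(δ_q)` on `T̄`
(`δ_q ∈ Γ_K` the inner correction of the datum at `q`); the eigenline structure there is proved under the LETTER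
`hΘ : T̄ = R·x⁺ ⊕ R·x⁻` with `Θ_q x^± = ±x^±`, `x^± ≠ 0` — which is H.5(a) verbatim when `ρ̄(δ_q) = 1`, but
`ρ̄(δ_q) ≠ 1` in general (Θ_q is the class of a FROBENIUS above `ℓ`, only conjugate to `θ`).  This file proves `hΘ`
for EVERY datum from Howard's hypotheses: at an engine prime `q = σq`, `σ̃_q² = τ⁻¹δ_qτ · δ_q` acts trivially on `T̄`
and `χ(δ_q) = 1` (`ConjugationDatumDeltaProofs`), so `Θ_q` is an INVOLUTION (`compat`); if it were `±1`, then
`ρ̄(δ_q) = ±θ` and H.5(c) `ē(θs, θt) = −ē(s,t)` together with H.4 `ē(ρ̄(δ)s, ρ̄(τ⁻¹δτ)t) = χ(δ) ē(s,t)` would give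
`ē = −ē`, i.e. `ē = 0` (`2 ∈ R^×`), contradicting the perfectness of the residual pairing; an involution `≠ ±1` of the
two-dimensional `k`-space `T̄` (H.5(a)) is a reflection.

* §1 (module theory, `R` local, `𝔪T̄ = 0`, `2 ∈ R^×`): **`exists_eigenpair_of_involutive`** — an `R`-linear involution
  `Θ ≠ ±1` of a module with an H.5(a)-shaped basis splits it into an H.5(a)-shaped pair of `Θ`-eigenvectors.
* §2 **`ResidualTau.theta_rho_delta_involutive`** (`Θ_q² = 1`), **`ResidualTau.hΘ_of_duality`** — `hΘ` from a
  residual duality datum `D̄` with `ē ∘ (θ × θ) = −ē`, H.5(a), `ρ̄(τ⁻¹δ_qτ · δ_q) = 1` on `T̄` and `χ(δ_q) = 1` in `R`.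

Cell `pub/bsd-print-x9`, G87 = Howard 2004 Thm. 1.6.1 (print leaf `stub_h161` of stmt-BirchSwinnertonDyer-22642);
seat `bsd-line-x10b-p1-w5` g9, brick R6-core (RES-EIGLINES, LEAD g12 ruling 08:05Z).  NOT HERE: the S-level
instantiation (`DVRSetting`, `exists_residualDualityDatum`, `datum_hχ`, HTRIV) — next file; `thm161_dvrKolyvaginBound`
is NOT proved; no summit statement is proved; BSD is not proved by any of this.

References: [Howard2004HeegnerKolyvagin] Lemma 1.5.3 (arXiv p. 10 L12–16), H.4/H.5 (p. 7 L69 – p. 8 L1), Prop. 1.1.7;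
[GrossLMS1991] §3 (3.3) (`Frob(ℓ)` is a complex conjugation on `E[p]`).
-/

set_option autoImplicit false

noncomputable section

open scoped NumberField
open NumberField IsDedekindDomain Field

/-! ## §1 An involution `≠ ±1` of an H.5(a)-module is a reflection -/

namespace Literature.Algebra.Module

variable {R : Type*} [CommRing R] [IsLocalRing R] {N : Type*} [AddCommGroup N] [Module R N]

/-- **An `R`-linear involution `Θ ≠ ±1` of a module `N` over a local ring `R` with `𝔪N = 0`, `2 ∈ R^×` and an
H.5(a)-shaped basis (`N = R·e⁺ + R·e⁻` with `e^± ≠ 0` the `±1`-eigenvectors of SOME involution `θ₀`) splits `N` into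
an H.5(a)-shaped pair of `Θ`-eigenvectors**: `N = R·x⁺ + R·x⁻`, `Θ x^± = ±x^±`, `x^± ≠ 0`.  (Linear algebra over the
residue field `k = R/𝔪`: `N` is a `2`-dimensional `k`-space, the `+1`-eigenspace of `Θ` is a proper non-zero
subspace, hence a line, and likewise for `−1`.) [cite: Howard2004HeegnerKolyvagin, §1.3 H.5(a) and Lemma 1.5.3 proof (arXiv p. 7 L93–95, p. 10 L12–16: «one-dimensional eigenspaces»)] -/
theorem exists_eigenpair_of_involutive (hm : ∀ a ∈ IsLocalRing.maximalIdeal R, ∀ x : N, a • x = 0)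
    (h2 : IsUnit (2 : R)) {θ₀ : N →ₗ[R] N} {ep em : N} (hep0 : ep ≠ 0) (hep : θ₀ ep = ep) (hem0 : em ≠ 0)
    (hem : θ₀ em = -em) (hspan : ∀ x : N, ∃ a b : R, x = a • ep + b • em)
    (Θ : N →ₗ[R] N) (hΘ : ∀ x, Θ (Θ x) = x) (hne1 : ∃ x, Θ x ≠ x) (hne2 : ∃ x, Θ x ≠ -x) :
    ∃ xp : N, xp ≠ 0 ∧ Θ xp = xp ∧ ∃ xm : N, xm ≠ 0 ∧ Θ xm = -xm ∧
      ∀ x : N, ∃ a b : R, x = a • xp + b • xm := by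
  classical
  -- ### the residue field `k` and the `k`-structure on `N`
  set 𝔪 := IsLocalRing.maximalIdeal R with h𝔪
  have hT : Module.IsTorsionBySet R N (𝔪 : Set R) := fun x a => hm a a.2 x
  letI : Module (R ⧸ 𝔪) N := hT.module
  letI : Field (R ⧸ 𝔪) := Ideal.Quotient.field 𝔪
  have hmk : ∀ (r : R) (x : N), (Ideal.Quotient.mk 𝔪 r) • x = r • x := fun r x => hT.mk_smul r x
  -- `R`-linear maps are `k`-linear
  have klin : ∀ (f : N →ₗ[R] N), ∃ g : N →ₗ[R ⧸ 𝔪] N, ∀ x, g x = f x := by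
    intro f
    refine ⟨{ toFun := f, map_add' := f.map_add, map_smul' := ?_ }, fun x => rfl⟩
    intro c x
    obtain ⟨r, rfl⟩ := Ideal.Quotient.mk_surjective c
    rw [hmk, map_smul, RingHom.id_apply, hmk]
  obtain ⟨Θk, hΘk⟩ := klin Θ
  -- no `2`-torsion
  have h2' : ∀ x : N, (2 : R) • x = 0 → x = 0 := by
    intro x hx
    obtain ⟨u, hu⟩ := h2
    have := congrArg (fun y => (↑u⁻¹ : R) • y) hx
    simpa [smul_smul, ← hu] using this
  -- ### `N` is two-dimensional over `k`, with basis `(ep, em)`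
  have hli : LinearIndependent (R ⧸ 𝔪) ![ep, em] := by
    rw [LinearIndependent.pair_iff]
    intro s t hst
    obtain ⟨a, rfl⟩ := Ideal.Quotient.mk_surjective s
    obtain ⟨b, rfl⟩ := Ideal.Quotient.mk_surjective t
    rw [hmk, hmk] at hst
    -- apply `θ₀`: `a ep - b em = 0`, so `2a ep = 0`, `2b em = 0`
    have h1 : a • ep - b • em = 0 := by
      have := congrArg θ₀ hst
      rwa [map_add, map_smul, map_smul, hep, hem, smul_neg, map_zero, ← sub_eq_add_neg] at this
    have ha : (2 : R) • (a • ep) = 0 := by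
      have h' : (a • ep + b • em) + (a • ep - b • em) = 0 := by rw [hst, h1, add_zero]
      rw [two_smul]
      rwa [show a • ep + b • em + (a • ep - b • em) = a • ep + a • ep by abel] at h'
    have hb : (2 : R) • (b • em) = 0 := by
      have h' : (a • ep + b • em) - (a • ep - b • em) = 0 := by rw [hst, h1, sub_zero]
      rw [two_smul]
      rwa [show a • ep + b • em - (a • ep - b • em) = b • em + b • em by abel] at h'
    have ha' := h2' _ ha
    have hb' := h2' _ hb
    -- `a ep = 0` with `ep ≠ 0` forces `a ∈ 𝔪`, i.e. `mk a = 0`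
    constructor
    · by_contra hne
      have hau : IsUnit a := by
        by_contra hau
        exact hne (Ideal.Quotient.eq_zero_iff_mem.mpr ((IsLocalRing.mem_maximalIdeal a).mpr hau))
      obtain ⟨u, rfl⟩ := hau
      apply hep0
      have := congrArg (fun y => (↑u⁻¹ : R) • y) ha'
      simpa [smul_smul] using this
    · by_contra hne
      have hbu : IsUnit b := by
        by_contra hbu
        exact hne (Ideal.Quotient.eq_zero_iff_mem.mpr ((IsLocalRing.mem_maximalIdeal b).mpr hbu))
      obtain ⟨u, rfl⟩ := hbu
      apply hem0
      have := congrArg (fun y => (↑u⁻¹ : R) • y) hb'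
      simpa [smul_smul] using this
  have hsp : ⊤ ≤ Submodule.span (R ⧸ 𝔪) (Set.range ![ep, em]) := by
    intro x _
    obtain ⟨a, b, rfl⟩ := hspan x
    rw [Matrix.range_cons, Matrix.range_cons, Matrix.range_empty, Set.union_empty]
    refine Submodule.add_mem _ ?_ ?_
    · rw [← hmk]
      exact Submodule.smul_mem _ _ (Submodule.subset_span (Set.mem_union_left _ (Set.mem_singleton _)))
    · rw [← hmk]
      exact Submodule.smul_mem _ _ (Submodule.subset_span (Set.mem_union_right _ (Set.mem_singleton _)))
  let B : Module.Basis (Fin 2) (R ⧸ 𝔪) N := Module.Basis.mk hli hsp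
  have hdim : Module.finrank (R ⧸ 𝔪) N = 2 := by
    rw [Module.finrank_eq_card_basis B, Fintype.card_fin]
  haveI : FiniteDimensional (R ⧸ 𝔪) N := Module.Finite.of_basis B
  -- ### in a `2`-dimensional space, a vector fixed by `Θ` is a multiple of any non-zero `Θ`-fixed vector unless
  -- `Θ = 1` (and likewise for `−1`): two independent vectors span
  have key : ∀ (ε : R ⧸ 𝔪) (w : N), w ≠ 0 → Θk w = ε • w → (∃ x, Θk x ≠ ε • x) →
      ∀ y : N, Θk y = ε • y → ∃ c : R ⧸ 𝔪, c • w = y := by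
    intro ε w hw0 hw hne y hy
    by_cases hind : LinearIndependent (R ⧸ 𝔪) ![y, w]
    · -- then `y, w` span `N`, and `Θ = ε` everywhere: contradiction
      exfalso
      obtain ⟨x, hx⟩ := hne
      have hspan2 : Submodule.span (R ⧸ 𝔪) (Set.range ![y, w]) = ⊤ :=
        hind.span_eq_top_of_card_eq_finrank' (by rw [hdim, Fintype.card_fin])
      have hxmem : x ∈ Submodule.span (R ⧸ 𝔪) (Set.range ![y, w]) := by rw [hspan2]; exact Submodule.mem_top
      rw [Matrix.range_cons, Matrix.range_cons, Matrix.range_empty, Set.union_empty,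
        Submodule.span_union, Submodule.mem_sup] at hxmem
      obtain ⟨y', hy', w', hw', rfl⟩ := hxmem
      obtain ⟨a, rfl⟩ := Submodule.mem_span_singleton.mp hy'
      obtain ⟨b, rfl⟩ := Submodule.mem_span_singleton.mp hw'
      apply hx
      rw [map_add, map_smul, map_smul, hy, hw, smul_add, smul_comm ε a, smul_comm ε b]
    · rw [LinearIndependent.pair_iff] at hind
      push Not at hind
      obtain ⟨s, t, hst, hst0⟩ := hind
      by_cases hs : s = 0
      · exfalso
        rw [hs, zero_smul, zero_add] at hst
        have ht : t ≠ 0 := fun ht => hst0 hs ht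
        exact hw0 ((smul_eq_zero.mp hst).resolve_left ht)
      · refine ⟨-(s⁻¹ * t), ?_⟩
        have : s • y = -(t • w) := eq_neg_of_add_eq_zero_left hst
        calc -(s⁻¹ * t) • w = s⁻¹ • (-(t • w)) := by rw [neg_smul, mul_smul, smul_neg]
          _ = s⁻¹ • (s • y) := by rw [this]
          _ = y := by rw [smul_smul, inv_mul_cancel₀ hs, one_smul]
  -- ### the eigenvectors
  obtain ⟨x₁, hx₁⟩ := hne2
  obtain ⟨x₂, hx₂⟩ := hne1
  set xp := x₁ + Θ x₁ with hxp
  set xm := x₂ - Θ x₂ with hxm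
  have hxpΘ : Θ xp = xp := by rw [hxp, map_add, hΘ, add_comm]
  have hxmΘ : Θ xm = -xm := by rw [hxm, map_sub, hΘ, neg_sub]
  have hxp0 : xp ≠ 0 := by
    intro h0
    rw [hxp] at h0
    exact hx₁ (eq_neg_of_add_eq_zero_right h0)
  have hxm0 : xm ≠ 0 := by
    intro h0
    apply hx₂
    rw [hxm, sub_eq_zero] at h0
    exact h0.symm
  refine ⟨xp, hxp0, hxpΘ, xm, hxm0, hxmΘ, fun x => ?_⟩
  -- `2x = (x + Θx) + (x - Θx)`, the two summands in the two eigenlines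
  have hp1 : Θk (x + Θ x) = (1 : R ⧸ 𝔪) • (x + Θ x) := by rw [hΘk, map_add, hΘ, add_comm, one_smul]
  have hm1 : Θk (x - Θ x) = (-1 : R ⧸ 𝔪) • (x - Θ x) := by rw [hΘk, map_sub, hΘ, neg_one_smul, neg_sub]
  have hne1' : ∃ z, Θk z ≠ (1 : R ⧸ 𝔪) • z := ⟨x₂, by rw [hΘk, one_smul]; exact hx₂⟩
  have hne2' : ∃ z, Θk z ≠ (-1 : R ⧸ 𝔪) • z := ⟨x₁, by rw [hΘk, neg_one_smul]; exact hx₁⟩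
  obtain ⟨c₁, hc₁⟩ := key 1 xp hxp0 (by rw [hΘk, hxpΘ, one_smul]) hne1' (x + Θ x) hp1
  obtain ⟨c₂, hc₂⟩ := key (-1) xm hxm0 (by rw [hΘk, hxmΘ, neg_one_smul]) hne2' (x - Θ x) hm1
  obtain ⟨a₁, rfl⟩ := Ideal.Quotient.mk_surjective c₁
  obtain ⟨a₂, rfl⟩ := Ideal.Quotient.mk_surjective c₂
  rw [hmk] at hc₁ hc₂
  obtain ⟨u, hu⟩ := h2
  refine ⟨(↑u⁻¹ : R) * a₁, (↑u⁻¹ : R) * a₂, ?_⟩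
  rw [mul_smul, mul_smul, hc₁, hc₂, ← smul_add,
    show x + Θ x + (x - Θ x) = (2 : R) • x by rw [two_smul]; abel, smul_smul, ← hu, Units.inv_mul,
    one_smul]

end Literature.Algebra.Module

/-! ## §2 `Θ_q = θ ∘ ρ̄(δ_q)` is a reflection, for every conjugation datum -/

namespace Literature.NumberTheory.GaloisCohomology.Howard2004

open Literature.NumberTheory.GaloisRepresentations
open Literature.NumberTheory.EllipticCurves
open Literature.Algebra.Module

namespace ResidualTau

variable {K : Type} [Field K] [NumberField K] {Nbar : Type} [AddCommGroup Nbar] [TopologicalSpace Nbar]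
  [DiscreteTopology Nbar] {R : Type} [CommRing R] [Module R Nbar] {cd : ConjugationDatum K}
  {ρbar : DiscreteGaloisModule K Nbar}

/-- **`Θ_q² = 1` on `T̄`** whenever `ρ̄(τ⁻¹δ_qτ · δ_q) = 1` on `T̄` (e.g. at an engine prime, where
`τ⁻¹δ_qτ · δ_q = σ̃_q² ∈ res Γ_{K_q}` acts trivially): `θ ∘ ρ̄(δ) = ρ̄(τ⁻¹δτ) ∘ θ` (H.5(a) compatibility, `τ` involutive).
[cite: Howard2004HeegnerKolyvagin, §1.3 H.5(a) (arXiv p. 7 L93–95)] -/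
theorem theta_rho_delta_involutive (A : ResidualTau (R := R) cd ρbar) {q : HeightOneSpectrum (𝓞 K)}
    (hδtriv : ∀ x : Nbar, ρbar (cd.conj (cd.δ q) * cd.δ q) x = x) (x : Nbar) :
    A.θ (ρbar (cd.δ q) (A.θ (ρbar (cd.δ q) x))) = x := by
  have h1 : A.θ (ρbar (cd.δ q) (A.θ (ρbar (cd.δ q) x))) =
      ρbar (cd.conj (cd.δ q)) (A.θ (A.θ (ρbar (cd.δ q) x))) := by
    have := A.compat (cd.conj (cd.δ q)) (A.θ (ρbar (cd.δ q) x))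
    rw [cd.isLift.conjGalCMH_conjGalCMH cd.involutive] at this
    exact this
  rw [h1, A.involutive]
  have h2 := hδtriv x
  rw [map_mul] at h2
  exact h2

/-- **The letter `hΘ` for EVERY conjugation datum**: `Θ_q := θ ∘ ρ̄(δ_q)` splits `T̄` into an H.5(a)-shaped pair of
eigenvectors, given H.5(a) for `θ`, a residual duality datum `D̄` (H.4 for `T̄`, perfect and `Γ_K`-equivariant) that is
ANTI-invariant under `θ` (H.5(c): `ē(θs, θt) = −ē(s,t)`), `ρ̄(τ⁻¹δ_qτ · δ_q) = 1` on `T̄`, `χ(δ_q) = 1` in `R`,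
`𝔪 T̄ = 0` and `2 ∈ R^×`.  Proof: `Θ_q² = 1`; if `Θ_q = ε ∈ {±1}` then `ρ̄(δ_q) = εθ` and
`−ē(s,t) = ē(θs, θt) = ē(ρ̄(δ)s, ρ̄(δ)t) = ē(s, ρ̄(δ)²t) = ē(s,t)` (H.5(c); H.4 at `g = δ_q` with
`ρ̄(τ⁻¹δτ) = ρ̄(δ)⁻¹`, `χ(δ) = 1`; `ρ̄(δ)² = θ² = 1`), so `ē = 0`, contradicting perfectness; now §1.
This is VERBATIM the binder `hΘ` of `transverse_/unramified_eigen_decomposition_and_line` and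
`…_exists_eigenclass_ne_zero` (`InertEigenlinesProofs`). [cite: Howard2004HeegnerKolyvagin, Lemma 1.5.3 proof (arXiv p. 10 L12–16) with H.4 / H.5 (p. 7 L69 – p. 8 L1)] [cite: GrossLMS1991, §3 (3.3)] -/
theorem hΘ_of_duality [IsLocalRing R] {p : ℕ} [Fact p.Prime] [TopologicalSpace R] [DiscreteTopology R]
    [Algebra ℤ_[p] R] (A : ResidualTau (R := R) cd ρbar) (hρ : ρbar.IsScalarLinear R)
    (D : DualityDatum p cd ρbar R) (hθe : ∀ x y : Nbar, D.e (A.θ x) (A.θ y) = -D.e x y)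
    (h5a : H5a (R := R) A) (hm : ∀ a ∈ IsLocalRing.maximalIdeal R, ∀ x : Nbar, a • x = 0)
    (h2 : IsUnit (2 : R)) {q : HeightOneSpectrum (𝓞 K)}
    (hδtriv : ∀ x : Nbar, ρbar (cd.conj (cd.δ q) * cd.δ q) x = x)
    (hχ : algebraMap ℤ_[p] R ((GaloisRep.cyclotomicCharacter K p (cd.δ q) : ℤ_[p]ˣ) : ℤ_[p]) = 1) :
    ∃ xp : Nbar, xp ≠ 0 ∧ A.θ (ρbar (cd.δ q) xp) = xp ∧ ∃ xm : Nbar, xm ≠ 0 ∧ A.θ (ρbar (cd.δ q) xm) = -xm ∧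
      ∀ x : Nbar, ∃ a b : R, x = a • xp + b • xm := by
  obtain ⟨ep, hep0, hep, em, hem0, hem, hspan⟩ := h5a
  -- `Θ` as an `R`-linear map
  let ρδ : Nbar →ₗ[R] Nbar :=
    { toFun := fun x => ρbar (cd.δ q) x
      map_add' := fun x y => map_add _ x y
      map_smul' := fun r x => hρ (cd.δ q) r x }
  let Θ : Nbar →ₗ[R] Nbar := A.θ ∘ₗ ρδ
  have hΘapply : ∀ x, Θ x = A.θ (ρbar (cd.δ q) x) := fun _ => rfl
  have hΘ2 : ∀ x, Θ (Θ x) = x := fun x => A.theta_rho_delta_involutive hδtriv x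
  -- ### the pairing argument: `Θ ≠ ±1`
  -- `ρ̄(τ⁻¹δτ)(ρ̄(δ) y) = y`
  have hinv : ∀ y : Nbar, ρbar (cd.conj (cd.δ q)) (ρbar (cd.δ q) y) = y := by
    intro y
    have := hδtriv y
    rwa [map_mul] at this
  -- `ρ̄(δ)` is self-adjoint for `ē` (H.4 at `g = δ_q`, `χ(δ_q) = 1`)
  have hSA : ∀ s y : Nbar, D.e (ρbar (cd.δ q) s) y = D.e s (ρbar (cd.δ q) y) := by
    intro s y
    have h := D.equivariant (cd.δ q) s (ρbar (cd.δ q) y)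
    rw [hχ, one_mul, hinv] at h
    exact h
  -- if `ē(ρ̄δ s, ρ̄δ t) = ē(θ s, θ t)` and `ρ̄δ ∘ ρ̄δ = 1`, the pairing vanishes: contradiction
  have hzero : (∀ s t : Nbar, D.e (ρbar (cd.δ q) s) (ρbar (cd.δ q) t) = D.e (A.θ s) (A.θ t)) →
      (∀ t : Nbar, ρbar (cd.δ q) (ρbar (cd.δ q) t) = t) → False := by
    intro hst hsq
    have hvan : ∀ s t : Nbar, D.e s t = 0 := by
      intro s t
      have h1 : D.e (A.θ s) (A.θ t) = D.e s t := by rw [← hst, hSA, hsq]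
      have h3 : (2 : R) * D.e s t = 0 := by
        have h2 := hθe s t
        rw [h1] at h2
        rw [two_mul]
        nth_rewrite 1 [h2]
        rw [neg_add_cancel]
      obtain ⟨u, hu⟩ := h2
      have := congrArg (fun z => (↑u⁻¹ : R) * z) h3
      simpa [← mul_assoc, ← hu] using this
    apply hep0
    apply D.perfect.1
    ext t
    rw [hvan, map_zero, LinearMap.zero_apply]
  have hne1 : ∃ x, Θ x ≠ x := by
    by_contra hall
    push Not at hall
    -- `Θ = 1`: `ρ̄δ = θ`
    have hρθ : ∀ x : Nbar, ρbar (cd.δ q) x = A.θ x := fun x => by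
      rw [← A.involutive (ρbar (cd.δ q) x), ← hΘapply, hall]
    exact hzero (fun s t => by rw [hρθ, hρθ]) (fun t => by rw [hρθ, hρθ, A.involutive])
  have hne2 : ∃ x, Θ x ≠ -x := by
    by_contra hall
    push Not at hall
    -- `Θ = -1`: `ρ̄δ = -θ`
    have hρθ : ∀ x : Nbar, ρbar (cd.δ q) x = -A.θ x := fun x => by
      rw [← A.involutive (ρbar (cd.δ q) x), ← hΘapply, hall, map_neg]
    exact hzero (fun s t => by rw [hρθ, hρθ, map_neg, map_neg, LinearMap.neg_apply, neg_neg])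
      (fun t => by rw [hρθ, hρθ, map_neg, A.involutive, neg_neg])
  -- ### conclude by §1
  obtain ⟨xp, hxp0, hxp, xm, hxm0, hxm, hsp⟩ :=
    exists_eigenpair_of_involutive hm h2 hep0 hep hem0 hem hspan Θ hΘ2 hne1 hne2
  exact ⟨xp, hxp0, hxp, xm, hxm0, hxm, hsp⟩

end ResidualTau

end Literature.NumberTheory.GaloisCohomology.Howard2004

end
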